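import Literature.Geometry.PolyhedralFans.RegularRefinement
import Literature.Geometry.PolyhedralFans.SupportFunction
import HarnessLib

/-!
# Crux `FrobeniusLadder.FRationalResolution` (stmt-ResolutionOfSingularities-15317), line `redirect`,
# stub `stub_diagonalizableQuotientResolution` — the face fan of a SIMPLICIAL lattice cone is primitively simplicial
# (hypothesis `hps` of the assembly (ε₁′) at `D(A)`-fixed points, where the cone is the image of an orthant)

`…PrimaryCentreAtIsolatedPointFan.exists_primary_monomialCentre_of_isolated'` and `Fan.exists_regular_refinement_isStrictSupport_sparing`
start from a PRIMITIVELY SIMPLICIAL face fan (`Fan.IsPrimSimplicial`: every cone is the hull of linearly independent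
primitive lattice vectors). For `σ = hull S` with `S` a linearly independent finite set of lattice vectors this holds: a
face of `σ` is `hull (S ∩ face)` (`eq_hull_filter_of_isFaceOf_hull`), and each generator may be replaced by the primitive
vector on its ray (`exists_isPrimitive_smul`) without changing hulls or independence.

* `linearIndepOn_image_smul` — rescaling generators by non-zero scalars keeps independence (the hull is unchanged by
  the tree's `hull_image_smul_eq`);
* **`Fan.isPrimSimplicial_ofCone_hull`** — the statement.

Honest label: fan combinatorics (no stub closed). No definitions, no named facts, no sorry. [cite: Fulton1993Toric, §1.2, §2.1, §2.6]
-/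

-- single-problem summit: the doubled namespace component is forced
set_option linter.dupNamespace false

namespace Literature.Geometry.PolyhedralFans

open PointedCone Finset

variable {κ : Type*} [Fintype κ]

omit [Fintype κ] in
/-- Rescaling linearly independent generators by non-zero scalars keeps them linearly independent (and the rescaling is
injective on them). [cite: Fulton1993Toric, §1.2] -/
theorem linearIndepOn_image_smul [DecidableEq (κ → ℚ)] {S : Finset (κ → ℚ)} (hli : LinearIndepOn ℚ id (S : Set (κ → ℚ)))
    (c : (κ → ℚ) → ℚ) (hc : ∀ s ∈ S, c s ≠ 0) :
    Set.InjOn (fun s => c s • s) (S : Set (κ → ℚ)) ∧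
      LinearIndepOn ℚ id ((S.image fun s => c s • s : Finset (κ → ℚ)) : Set (κ → ℚ)) := by
  classical
  have hcrit := linearIndepOn_finset_iffₛ.mp hli
  -- injectivity
  have hsum : ∀ (x : κ → ℚ), x ∈ S → ∀ a : ℚ, ∑ i ∈ S, (if i = x then a else 0) • id i = a • x := by
    intro x hx a
    rw [Finset.sum_eq_single x]
    · simp
    · intro i _ hix; simp [hix]
    · intro h; exact absurd hx h
  have hinj : Set.InjOn (fun s => c s • s) (S : Set (κ → ℚ)) := by
    intro s hs s' hs' hss'
    by_contra hne
    have hs₀ := Finset.mem_coe.1 hs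
    have hs₀' := Finset.mem_coe.1 hs'
    have h := hcrit (fun x => if x = s then c s else 0) (fun x => if x = s' then c s' else 0)
      (by rw [hsum s hs₀, hsum s' hs₀']; exact hss') s hs₀
    rw [if_pos rfl, if_neg hne] at h
    exact hc s hs₀ h
  refine ⟨hinj, ?_⟩
  rw [linearIndepOn_finset_iffₛ]
  intro f g hfg t ht
  obtain ⟨s, hs, rfl⟩ := Finset.mem_image.1 ht
  rw [Finset.sum_image (fun x hx y hy h => hinj (Finset.mem_coe.2 hx) (Finset.mem_coe.2 hy) h),
    Finset.sum_image (fun x hx y hy h => hinj (Finset.mem_coe.2 hx) (Finset.mem_coe.2 hy) h)] at hfg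
  simp only [id, smul_smul] at hfg
  have h := hcrit (fun x => f (c x • x) * c x) (fun x => g (c x • x) * c x) hfg s hs
  exact mul_right_cancel₀ (hc s hs) h

namespace Fan

/-- **The face fan of a simplicial lattice cone is primitively simplicial.** If `σ = hull S` for a linearly independent
finite set `S` of lattice vectors (e.g. the image of an orthant under a lattice isomorphism), then every face of `σ` is
the hull of linearly independent PRIMITIVE lattice vectors. [cite: Fulton1993Toric, §1.2 (2), §2.6 p. 48] -/
theorem isPrimSimplicial_ofCone_hull [DecidableEq κ] {S : Finset (κ → ℚ)} (hSN : ∀ s ∈ S, s ∈ latticeN κ)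
    (hli : LinearIndepOn ℚ id (S : Set (κ → ℚ))) (hfg : (PointedCone.hull ℚ (S : Set (κ → ℚ))).FG)
    (hsal : IsSalient (PointedCone.hull ℚ (S : Set (κ → ℚ)))) :
    (Fan.ofCone (PointedCone.hull ℚ (S : Set (κ → ℚ))) hfg hsal).IsPrimSimplicial := by
  classical
  intro ρ hρ
  rw [Fan.mem_ofCone_iff] at hρ
  -- the face is the hull of the generators it contains
  set S' := S.filter (· ∈ ρ) with hS'
  have hρS' : ρ = PointedCone.hull ℚ (S' : Set (κ → ℚ)) := eq_hull_filter_of_isFaceOf_hull hρ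
  have hS'S : S' ⊆ S := Finset.filter_subset _ _
  have hli' : LinearIndepOn ℚ id (S' : Set (κ → ℚ)) := hli.mono (Finset.coe_subset.2 hS'S)
  -- primitive rescaling
  have h0 : ∀ s ∈ S', s ≠ 0 := fun s hs h0 => hli'.ne_zero hs (by simpa using h0)
  have hc : ∀ s ∈ S', ∃ c : ℚ, 0 < c ∧ IsPrimitive (c • s) := fun s hs => by
    obtain ⟨c, hc0, -, hprim⟩ := exists_isPrimitive_smul (hSN s (hS'S hs)) (h0 s hs)
    exact ⟨c, hc0, hprim⟩
  choose! c hc0 hprim using hc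
  refine ⟨S'.image fun s => c s • s, ?_, (linearIndepOn_image_smul hli' c fun s hs => (hc0 s hs).ne').2, ?_⟩
  · intro x hx
    obtain ⟨s, hs, rfl⟩ := Finset.mem_image.1 (Finset.mem_coe.1 hx)
    exact hprim s hs
  · rw [hρS', hull_image_smul_eq S' c hc0]

end Fan

end Literature.Geometry.PolyhedralFans
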